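import Summits.MatrixMultiplication.MatrixMultiplication.Theses.GLnSeparatingDesigns

/-!
# Exact half-dimensional designs give border half-dimensional designs

Support glue for route `GLnSeparatingDesigns` (BlasiakCohnGrochowPrattUmans2024, arXiv:2410.14905,
§4 p. 33 key question): the EXACT reading `ExactHalfDimensionDesigns` (honest separating polynomials,
Def. 2.1) implies the border reading `BorderHalfDimensionDesigns` (η-approximate separators, the
hypothesis of the route's deciding theorem `closes`), uniformly in the tolerance `η`: an exact
separator has error `0 ≤ η` at every point of `X Y⁻¹ Y Z⁻¹`.
-/

-- repeats `MatrixMultiplication` (summit = sub-problem), which `linter.dupNamespace` would flag.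
set_option linter.dupNamespace false
namespace Summit.MatrixMultiplication.MatrixMultiplication.Theorems

open Summit.MatrixMultiplication.MatrixMultiplication.Theses.GLnSeparatingDesigns

/-- BCGPU 2024 §4 key question, exact reading ⇒ border reading: a TPP design in `GL_n(ℂ)` with
honest separating polynomials (value `1` at the target, `0` elsewhere on `X Y⁻¹ Y Z⁻¹`) is, for every
tolerance `η > 0`, a design with `η`-approximate separating polynomials of the same degree; hence
`ExactHalfDimensionDesigns → BorderHalfDimensionDesigns` (the sets do not depend on `η`). -/
theorem borderHalfDimensionDesigns_of_exact (h : ExactHalfDimensionDesigns) :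
    BorderHalfDimensionDesigns := by
  intro ε hε
  obtain ⟨n, hn, H⟩ := h ε hε
  refine ⟨n, hn, fun δ hδ q₀ => ?_⟩
  obtain ⟨q, hq, X, Y, Z, htpp, hX, hY, hZ, hsep⟩ := H δ hδ q₀
  refine ⟨q, hq, fun η hη => ⟨X, Y, Z, htpp, hX, hY, hZ, ?_⟩⟩
  intro x₀ hx₀ z₀ hz₀
  obtain ⟨p, hp, hs⟩ := hsep x₀ hx₀ z₀ hz₀
  refine ⟨p, hp, fun x hx y hy y' hy' z hz => ?_⟩
  obtain ⟨h1, h0⟩ := hs x hx y hy y' hy' z hz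
  refine ⟨fun hc => ?_, fun hc => ?_⟩
  · rw [h1 hc, sub_self, norm_zero]
    exact hη.le
  · rw [h0 hc, norm_zero]
    exact hη.le

end Summit.MatrixMultiplication.MatrixMultiplication.Theorems
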